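import Mathlib
import Summits.ValiantsHypothesis.ValiantsHypothesis.Theorems.LacunarySymmetroidMatrixDescartesDefiniteMomentsZonesRayleigh

/-!
# `MatrixDescartes` (stmt-ValiantsHypothesis-18050) — the DEFINITE-MOMENTS LAW, zones IV: the loop-counting lemmas
# and the algebra of the planar path `u(t) = (1 − t²)·v + 2t·w`

HONEST FRAMING.  Cell `pub-symmetroid`, seat `val-sym-mdr-p2` (gen 15); helper file `--supports` the crux
`Theses.LacunarySymmetroid.MatrixDescartes`, NO closure claim.  Generic topology/algebra for the planar step of the lacunary
Markus theorem; nothing here bears on the crux in its window, on `stub_twoSided`, on `DoorA26`/`DoorA34`, registers, or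
`VP ≠ VNP`.

CONTENT.  (§1) A locally constant `ℕ`-valued function on a preconnected set of reals is constant.  (§2) `loop_count`: an
index function `I : ℝ → ℕ` along `[−1, 1]` that is locally constant off the zeros of a test function `Q`, jumps by at most
one at a zero, sees at most two zeros in `(−1, 1)` (none at `0, ±1`) and has `I(−1) = I(1)` satisfies `|I(0) − I(1)| ≤ 1`.
(§3) `touch_count`: the touching configuration (`Q(0) = Q(±1) = 0`, `I(±1) = I(0) + 1`, `Q` either identically zero or
non-zero off `{0, ±1}` with `Q(½)·Q(−½) < 0`, equal index ⇒ equal sign) is impossible.  (§4) Algebra of the path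
`u(t) = (1 − t²)v + 2t·w`: it avoids the origin for independent `v, w`; the Rayleigh value of `a·v + b·w` is the binary form
`a²·f_v + 2ab·g + b²·f_w`; through `α = (1 − t²)/(2t)` (injective on `(−1,1) ∖ {0}`) the zeros of
`t ↦ (1−t²)²A + 2(1−t²)(2t)B + (2t)²C` with `A ≠ 0` are roots of `Aα² + 2Bα + C`, so there are at most two in `(−1, 1)`.
[folklore]; axioms `propext`, `Classical.choice`, `Quot.sound`; no definitions.
-/

-- layout Summits/ValiantsHypothesis/ValiantsHypothesis forces the duplicated namespace component
set_option linter.dupNamespace false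

namespace Summit.ValiantsHypothesis.ValiantsHypothesis.Theorems.LacunarySymmetroidMatrixDescartes

open Polynomial Matrix Finset
open scoped BigOperators Topology

namespace DefiniteMoments

/-! ## §1 Locally constant on a preconnected set ⇒ constant -/

/-- A function `ℝ → ℕ` that is locally constant within a preconnected set `J` is constant on `J`. [folklore] -/
theorem constant_of_locallyConstant {f : ℝ → ℕ} {J : Set ℝ} (hJ : IsPreconnected J)
    (hloc : ∀ t ∈ J, ∀ᶠ s in 𝓝[J] t, f s = f t) {x y : ℝ} (hx : x ∈ J) (hy : y ∈ J) : f x = f y := by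
  have hcont : ContinuousOn f J := by
    intro t ht
    have h : Filter.Tendsto f (𝓝[J] t) (𝓝 (f t)) :=
      tendsto_const_nhds.congr' ((hloc t ht).mono fun s hs => hs.symm)
    exact h
  exact hJ.constant hcont hx hy

/-- Constancy on a zero-free preconnected piece: if `I` is locally constant (in `ℝ`) at every point of `J` then it is
constant on `J`. [folklore] -/
theorem constant_of_nhds {I : ℝ → ℕ} {J : Set ℝ} (hJ : IsPreconnected J)
    (hloc : ∀ t ∈ J, ∀ᶠ s in 𝓝 t, I s = I t) {x y : ℝ} (hx : x ∈ J) (hy : y ∈ J) : I x = I y :=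
  constant_of_locallyConstant hJ (fun t ht => (hloc t ht).filter_mono nhdsWithin_le_nhds) hx hy

/-! ## §2 The loop count -/

/-- **LOOP COUNT.**  `I : ℝ → ℕ`, `Q : ℝ → ℝ` on `[−1, 1]`: `I` is locally constant at every non-zero of `Q`; at a zero of
`Q` the nearby values of `I` lie in some `{m, m+1}`; `Q` has no three zeros in `(−1, 1)` and does not vanish at `0, ±1`;
`I(−1) = I(1)`.  Then `I(0)` and `I(1)` differ by at most one. [folklore] -/
theorem loop_count (I : ℝ → ℕ) (Q : ℝ → ℝ)
    (h1 : ∀ t₀ ∈ Set.Icc (-1 : ℝ) 1, Q t₀ ≠ 0 → ∀ᶠ t in 𝓝 t₀, I t = I t₀)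
    (h2 : ∀ t₀ ∈ Set.Icc (-1 : ℝ) 1, Q t₀ = 0 → ∃ m : ℕ, ∀ᶠ t in 𝓝 t₀, m ≤ I t ∧ I t ≤ m + 1)
    (h3 : ∀ t₁ t₂ t₃ : ℝ, -1 < t₁ → t₁ < t₂ → t₂ < t₃ → t₃ < 1 → Q t₁ = 0 → Q t₂ = 0 → Q t₃ = 0 → False)
    (hQ0 : Q 0 ≠ 0) (hQ1 : Q 1 ≠ 0) (hQm1 : Q (-1) ≠ 0) (hends : I (-1) = I 1) :
    I 0 ≤ I 1 + 1 ∧ I 1 ≤ I 0 + 1 := by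
  have hconst : ∀ J : Set ℝ, IsPreconnected J → J ⊆ Set.Icc (-1) 1 → (∀ t ∈ J, Q t ≠ 0) →
      ∀ x y : ℝ, x ∈ J → y ∈ J → I x = I y := fun J hJ hsub hQ x y hx hy =>
    constant_of_nhds hJ (fun t ht => h1 t (hsub ht) (hQ t ht)) hx hy
  by_cases hA : ∃ t ∈ Set.Icc (-1 : ℝ) 0, Q t = 0
  · by_cases hB : ∃ t ∈ Set.Icc (0 : ℝ) 1, Q t = 0
    · obtain ⟨t₁, ht₁, hQt₁⟩ := hA
      obtain ⟨t₂, ht₂, hQt₂⟩ := hB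
      have ht₁a : -1 < t₁ := lt_of_le_of_ne ht₁.1 fun h => hQm1 (by rw [h]; exact hQt₁)
      have ht₁b : t₁ < 0 := lt_of_le_of_ne ht₁.2 fun h => hQ0 (by rw [h] at hQt₁; exact hQt₁)
      have ht₂a : 0 < t₂ := lt_of_le_of_ne ht₂.1 fun h => hQ0 (by rw [← h] at hQt₂; exact hQt₂)
      have ht₂b : t₂ < 1 := lt_of_le_of_ne ht₂.2 fun h => hQ1 (by rw [← h]; exact hQt₂)
      -- no further zero: `Q ≠ 0` on `(t₁, t₂)` and on `[-1, t₁)`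
      have hmid : ∀ t ∈ Set.Ioo t₁ t₂, Q t ≠ 0 := fun t ht hQt =>
        h3 t₁ t t₂ ht₁a ht.1 ht.2 ht₂b hQt₁ hQt hQt₂
      have hleft : ∀ t ∈ Set.Ico (-1 : ℝ) t₁, Q t ≠ 0 := fun t ht hQt => by
        have htm1 : -1 < t := lt_of_le_of_ne ht.1 fun h => hQm1 (by rw [h]; exact hQt)
        exact h3 t t₁ t₂ htm1 ht.2 (by linarith) ht₂b hQt hQt₁ hQt₂
      -- the jump window at `t₁`
      obtain ⟨m, hm⟩ := h2 t₁ ⟨ht₁.1, by linarith⟩ hQt₁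
      obtain ⟨ε, hε, hball⟩ := Metric.eventually_nhds_iff.1 hm
      set tL := max (t₁ - ε / 2) ((-1 + t₁) / 2) with htL
      set tR := min (t₁ + ε / 2) ((t₁ + t₂) / 2) with htR
      have htL1 : tL < t₁ := max_lt (by linarith) (by linarith)
      have htL2 : -1 < tL := lt_max_of_lt_right (by linarith)
      have htL3 : t₁ - ε / 2 ≤ tL := le_max_left _ _
      have htR1 : t₁ < tR := lt_min (by linarith) (by linarith)
      have htR2 : tR < t₂ := min_lt_of_right_lt (by linarith)
      have htR3 : tR ≤ t₁ + ε / 2 := min_le_left _ _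
      have hdL : dist tL t₁ < ε := by
        rw [Real.dist_eq, abs_sub_comm, abs_of_pos (by linarith)]; linarith
      have hdR : dist tR t₁ < ε := by
        rw [Real.dist_eq, abs_of_pos (by linarith)]; linarith
      have hIL : I tL = I (-1) :=
        hconst (Set.Ico (-1) t₁) isPreconnected_Ico (fun t ht => ⟨ht.1, by linarith [ht.2]⟩) hleft tL (-1)
          ⟨htL2.le, htL1⟩ ⟨le_rfl, ht₁a⟩
      have hIR : I tR = I 0 :=
        hconst (Set.Ioo t₁ t₂) isPreconnected_Ioo (fun t ht => ⟨by linarith [ht.1], by linarith [ht.2]⟩) hmid tR 0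
          ⟨htR1, htR2⟩ ⟨ht₁b, ht₂a⟩
      have hbL := hball hdL
      have hbR := hball hdR
      rw [hIL, hends] at hbL
      rw [hIR] at hbR
      constructor <;> omega
    · push Not at hB
      have h := hconst (Set.Icc 0 1) isPreconnected_Icc (fun t ht => ⟨by linarith [ht.1], ht.2⟩) hB 0 1
        ⟨le_rfl, zero_le_one⟩ ⟨zero_le_one, le_rfl⟩
      constructor <;> omega
  · push Not at hA
    have h := hconst (Set.Icc (-1) 0) isPreconnected_Icc (fun t ht => ⟨ht.1, by linarith [ht.2]⟩) hA (-1) 0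
      ⟨le_rfl, by norm_num⟩ ⟨by norm_num, le_rfl⟩
    rw [hends] at h
    constructor <;> omega

/-! ## §3 The touching configuration is impossible -/

/-- **TOUCH COUNT.**  `I : ℝ → ℕ`, `Q : ℝ → ℝ` on `[−1, 1]` with: `I` locally constant at non-zeros of `Q`; at a zero `t₀`
the nearby values satisfy `I t₀ ≤ I t ≤ I t₀ + 1`, with equality `I t = I t₀` wherever `Q t = 0` too; equal index at two
non-zeros forces equal sign (`Q t·Q t' > 0`); `Q(0) = Q(±1) = 0`; and either `Q ≡ 0` on `[−1, 1]` or `Q ≠ 0` off `{0, ±1}`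
with `Q(½)·Q(−½) < 0`.  Then `I(−1) = I(1) = I(0) + 1` is impossible. [folklore] -/
theorem touch_count (I : ℝ → ℕ) (Q : ℝ → ℝ)
    (h1 : ∀ t₀ ∈ Set.Icc (-1 : ℝ) 1, Q t₀ ≠ 0 → ∀ᶠ t in 𝓝 t₀, I t = I t₀)
    (h2 : ∀ t₀ ∈ Set.Icc (-1 : ℝ) 1, Q t₀ = 0 →
      ∀ᶠ t in 𝓝 t₀, I t₀ ≤ I t ∧ I t ≤ I t₀ + 1 ∧ (Q t = 0 → I t = I t₀))
    (hpar : ∀ t t' : ℝ, t ∈ Set.Icc (-1 : ℝ) 1 → t' ∈ Set.Icc (-1 : ℝ) 1 → Q t ≠ 0 → Q t' ≠ 0 → I t = I t' →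
      0 < Q t * Q t')
    (hQ : (∀ t ∈ Set.Icc (-1 : ℝ) 1, Q t = 0) ∨
      ((∀ t : ℝ, -1 < t → t < 1 → t ≠ 0 → Q t ≠ 0) ∧ Q (1 / 2) * Q (-1 / 2) < 0))
    (hQ0 : Q 0 = 0) (hQ1 : Q 1 = 0) (hQm1 : Q (-1) = 0)
    (hends : I (-1) = I 1) (hstep : I 1 = I 0 + 1) : False := by
  rcases hQ with hzero | ⟨hnz, hsign⟩
  · -- persistent zero: `I` is locally constant within `[-1, 1]`, hence constant there
    have hloc : ∀ t ∈ Set.Icc (-1 : ℝ) 1, ∀ᶠ s in 𝓝[Set.Icc (-1 : ℝ) 1] t, I s = I t := by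
      intro t ht
      have h := (h2 t ht (hzero t ht)).filter_mono (nhdsWithin_le_nhds (s := Set.Icc (-1 : ℝ) 1))
      filter_upwards [h, eventually_mem_nhdsWithin] with s hs hsmem
      exact hs.2.2 (hzero s hsmem)
    have h := constant_of_locallyConstant isPreconnected_Icc hloc (x := (0 : ℝ)) (y := 1)
      ⟨by norm_num, by norm_num⟩ ⟨by norm_num, le_rfl⟩
    omega
  · have hconst : ∀ J : Set ℝ, IsPreconnected J → J ⊆ Set.Icc (-1) 1 → (∀ t ∈ J, Q t ≠ 0) →
        ∀ x y : ℝ, x ∈ J → y ∈ J → I x = I y := fun J hJ hsub hQ' x y hx hy =>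
      constant_of_nhds hJ (fun t ht => h1 t (hsub ht) (hQ' t ht)) hx hy
    have hpos : ∀ t ∈ Set.Ioo (0 : ℝ) 1, Q t ≠ 0 := fun t ht => hnz t (by linarith [ht.1]) ht.2 (ne_of_gt ht.1)
    have hneg : ∀ t ∈ Set.Ioo (-1 : ℝ) 0, Q t ≠ 0 := fun t ht => hnz t ht.1 (by linarith [ht.2]) (ne_of_lt ht.2)
    have hcR : ∀ x y : ℝ, x ∈ Set.Ioo (0 : ℝ) 1 → y ∈ Set.Ioo (0 : ℝ) 1 → I x = I y :=
      hconst _ isPreconnected_Ioo (fun t ht => ⟨by linarith [ht.1], ht.2.le⟩) hpos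
    have hcL : ∀ x y : ℝ, x ∈ Set.Ioo (-1 : ℝ) 0 → y ∈ Set.Ioo (-1 : ℝ) 0 → I x = I y :=
      hconst _ isPreconnected_Ioo (fun t ht => ⟨ht.1.le, by linarith [ht.2]⟩) hneg
    -- windows at `0`, `1`, `-1`
    obtain ⟨ε₀, hε₀, hb₀⟩ := Metric.eventually_nhds_iff.1 (h2 0 ⟨by norm_num, by norm_num⟩ hQ0)
    obtain ⟨ε₁, hε₁, hb₁⟩ := Metric.eventually_nhds_iff.1 (h2 1 ⟨by norm_num, le_rfl⟩ hQ1)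
    obtain ⟨ε₂, hε₂, hb₂⟩ := Metric.eventually_nhds_iff.1 (h2 (-1) ⟨le_rfl, by norm_num⟩ hQm1)
    -- sample points
    set sR := min (ε₀ / 2) (1 / 2) with hsR
    set sL := -sR with hsL
    set s1 := max (1 - ε₁ / 2) (1 / 2) with hs1
    set sm := -max (1 - ε₂ / 2) (1 / 2) with hsm
    have hsR0 : 0 < sR := lt_min (by linarith) (by norm_num)
    have hsR1 : sR ≤ 1 / 2 := min_le_right _ _
    have hsRε : sR ≤ ε₀ / 2 := min_le_left _ _
    have hs1a : 1 / 2 ≤ s1 := le_max_right _ _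
    have hs1b : s1 < 1 := max_lt (by linarith) (by norm_num)
    have hs1ε : 1 - ε₁ / 2 ≤ s1 := le_max_left _ _
    have hsma : 1 / 2 ≤ max (1 - ε₂ / 2) (1 / 2) := le_max_right _ _
    have hsmb : max (1 - ε₂ / 2) (1 / 2) < 1 := max_lt (by linarith) (by norm_num)
    have hsmε : 1 - ε₂ / 2 ≤ max (1 - ε₂ / 2) (1 / 2) := le_max_left _ _
    have hR := hb₀ (show dist sR 0 < ε₀ by rw [Real.dist_eq, sub_zero, abs_of_pos hsR0]; linarith)
    have hL := hb₀ (show dist sL 0 < ε₀ by rw [Real.dist_eq, sub_zero, hsL, abs_neg, abs_of_pos hsR0]; linarith)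
    have h1' := hb₁ (show dist s1 1 < ε₁ by rw [Real.dist_eq, abs_sub_comm, abs_of_pos (by linarith)]; linarith)
    have hm' := hb₂ (show dist sm (-1) < ε₂ by
      rw [Real.dist_eq, hsm, show -max (1 - ε₂ / 2) (1 / 2) - -1 = 1 - max (1 - ε₂ / 2) (1 / 2) by ring,
        abs_of_pos (by linarith)]; linarith)
    -- constancy on the two arcs
    have e1 : I sR = I s1 := hcR sR s1 ⟨hsR0, by linarith⟩ ⟨by linarith, hs1b⟩
    have e2 : I sL = I sm := hcL sL sm ⟨by rw [hsL]; linarith, by rw [hsL]; linarith⟩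
      ⟨by rw [hsm]; linarith, by rw [hsm]; linarith⟩
    have e3 : I (1 / 2) = I sR := hcR _ _ ⟨by norm_num, by norm_num⟩ ⟨hsR0, by linarith⟩
    have e4 : I (-1 / 2) = I sL := hcL _ _ ⟨by norm_num, by norm_num⟩ ⟨by rw [hsL]; linarith, by rw [hsL]; linarith⟩
    have hvals : I (1 / 2) = I (-1 / 2) := by
      rw [hends] at hm'
      omega
    have hp := hpar (1 / 2) (-1 / 2) ⟨by norm_num, by norm_num⟩ ⟨by norm_num, by norm_num⟩
      (hnz _ (by norm_num) (by norm_num) (by norm_num)) (hnz _ (by norm_num) (by norm_num) (by norm_num)) hvals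
    linarith

/-! ## §4 Algebra of the planar path -/

section Path

variable {ι : Type} [Fintype ι]

omit [Fintype ι] in
/-- For independent `v, w` the path `u(t) = (1 − t²)·v + 2t·w` avoids the origin. [folklore] -/
theorem path_ne_zero (v w : ι → ℝ) (hind : ∀ a b : ℝ, a • v + b • w = 0 → a = 0 ∧ b = 0) (t : ℝ) :
    (1 - t ^ 2) • v + (2 * t) • w ≠ 0 := by
  intro h
  obtain ⟨h1, h2⟩ := hind _ _ h
  have ht : t = 0 := by linarith
  rw [ht] at h1
  norm_num at h1

/-- Symmetric matrices: `wᵀAv = vᵀAw`. [folklore] -/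
theorem dotProduct_mulVec_symm (A : Matrix ι ι ℝ) (hA : A.IsSymm) (v w : ι → ℝ) :
    w ⬝ᵥ (A *ᵥ v) = v ⬝ᵥ (A *ᵥ w) := by
  calc w ⬝ᵥ (A *ᵥ v) = (w ᵥ* A) ⬝ᵥ v := (Matrix.dotProduct_mulVec w A v)
    _ = (Aᵀ *ᵥ w) ⬝ᵥ v := by rw [Matrix.mulVec_transpose]
    _ = (A *ᵥ w) ⬝ᵥ v := by rw [hA.eq]
    _ = v ⬝ᵥ (A *ᵥ w) := dotProduct_comm _ _

/-- **The binary form of a plane.**  For symmetric `A`: `(a·v + b·w)ᵀA(a·v + b·w) = a²·vᵀAv + 2ab·vᵀAw + b²·wᵀAw`.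
[folklore] -/
theorem form_plane (A : Matrix ι ι ℝ) (hA : A.IsSymm) (v w : ι → ℝ) (a b : ℝ) :
    (a • v + b • w) ⬝ᵥ (A *ᵥ (a • v + b • w))
      = a ^ 2 * (v ⬝ᵥ (A *ᵥ v)) + 2 * a * b * (v ⬝ᵥ (A *ᵥ w)) + b ^ 2 * (w ⬝ᵥ (A *ᵥ w)) := by
  rw [Matrix.mulVec_add, Matrix.mulVec_smul, Matrix.mulVec_smul, add_dotProduct, dotProduct_add, dotProduct_add,
    smul_dotProduct, smul_dotProduct, smul_dotProduct, smul_dotProduct, dotProduct_smul, dotProduct_smul,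
    dotProduct_smul, dotProduct_smul, dotProduct_mulVec_symm A hA v w]
  simp only [smul_eq_mul]
  ring

/-- A real quadratic `Aα² + 2Bα + C` with `A ≠ 0` has no three distinct roots. [folklore] -/
theorem quadratic_no_three_roots {A B C : ℝ} (hA : A ≠ 0) {α₁ α₂ α₃ : ℝ} (h12 : α₁ ≠ α₂) (h13 : α₁ ≠ α₃)
    (h23 : α₂ ≠ α₃) (h1 : A * α₁ ^ 2 + 2 * B * α₁ + C = 0) (h2 : A * α₂ ^ 2 + 2 * B * α₂ + C = 0)
    (h3 : A * α₃ ^ 2 + 2 * B * α₃ + C = 0) : False := by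
  have e12 : A * (α₁ + α₂) + 2 * B = 0 := by
    have h : (α₁ - α₂) * (A * (α₁ + α₂) + 2 * B) = 0 := by linear_combination h1 - h2
    rcases mul_eq_zero.1 h with h | h
    · exact absurd (sub_eq_zero.1 h) h12
    · exact h
  have e13 : A * (α₁ + α₃) + 2 * B = 0 := by
    have h : (α₁ - α₃) * (A * (α₁ + α₃) + 2 * B) = 0 := by linear_combination h1 - h3
    rcases mul_eq_zero.1 h with h | h
    · exact absurd (sub_eq_zero.1 h) h13
    · exact h
  have h : A * (α₂ - α₃) = 0 := by linear_combination e12 - e13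
  rcases mul_eq_zero.1 h with h | h
  · exact hA h
  · exact h23 (sub_eq_zero.1 h)

/-- `α(t) = (1 − t²)/(2t)` is injective on `(−1, 1) ∖ {0}`. [folklore] -/
theorem alpha_inj {t t' : ℝ} (ht1 : -1 < t) (ht2 : t < 1) (ht0 : t ≠ 0) (ht1' : -1 < t') (ht2' : t' < 1)
    (ht0' : t' ≠ 0) (h : (1 - t ^ 2) / (2 * t) = (1 - t' ^ 2) / (2 * t')) : t = t' := by
  rw [div_eq_div_iff (mul_ne_zero two_ne_zero ht0) (mul_ne_zero two_ne_zero ht0')] at h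
  have h' : (t' - t) * (1 + t * t') = 0 := by linear_combination h / 2
  rcases mul_eq_zero.1 h' with h'' | h''
  · exact (sub_eq_zero.1 h'').symm
  · nlinarith [sq_nonneg (t + t'), mul_pos (sub_pos.2 ht2) (sub_pos.2 ht2'), mul_pos (neg_lt_iff_pos_add.1 ht1) (sub_pos.2 ht2')]

/-- Factorisation of the path value for `t ≠ 0`: `(1−t²)²A + 2(1−t²)(2t)B + (2t)²C = (2t)²·(Aα² + 2Bα + C)`,
`α = (1 − t²)/(2t)`. [folklore] -/
theorem path_value_factor (A B C t : ℝ) (ht : t ≠ 0) :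
    (1 - t ^ 2) ^ 2 * A + 2 * (1 - t ^ 2) * (2 * t) * B + (2 * t) ^ 2 * C
      = (2 * t) ^ 2 * (A * ((1 - t ^ 2) / (2 * t)) ^ 2 + 2 * B * ((1 - t ^ 2) / (2 * t)) + C) := by
  field_simp

/-- **At most two zeros on the path.**  With `A ≠ 0`, `t ↦ (1−t²)²A + 2(1−t²)(2t)B + (2t)²C` has no three zeros in
`(−1, 1)`. [folklore] -/
theorem path_no_three_zeros {A B C : ℝ} (hA : A ≠ 0) (t₁ t₂ t₃ : ℝ) (h1 : -1 < t₁) (h12 : t₁ < t₂) (h23 : t₂ < t₃)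
    (h3 : t₃ < 1)
    (hz1 : (1 - t₁ ^ 2) ^ 2 * A + 2 * (1 - t₁ ^ 2) * (2 * t₁) * B + (2 * t₁) ^ 2 * C = 0)
    (hz2 : (1 - t₂ ^ 2) ^ 2 * A + 2 * (1 - t₂ ^ 2) * (2 * t₂) * B + (2 * t₂) ^ 2 * C = 0)
    (hz3 : (1 - t₃ ^ 2) ^ 2 * A + 2 * (1 - t₃ ^ 2) * (2 * t₃) * B + (2 * t₃) ^ 2 * C = 0) : False := by
  -- none of the zeros is `0`
  have hne : ∀ t : ℝ, (1 - t ^ 2) ^ 2 * A + 2 * (1 - t ^ 2) * (2 * t) * B + (2 * t) ^ 2 * C = 0 → t ≠ 0 := by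
    intro t ht h0
    rw [h0] at ht
    norm_num at ht
    exact hA ht
  have h10 := hne t₁ hz1
  have h20 := hne t₂ hz2
  have h30 := hne t₃ hz3
  have root : ∀ t : ℝ, t ≠ 0 → (1 - t ^ 2) ^ 2 * A + 2 * (1 - t ^ 2) * (2 * t) * B + (2 * t) ^ 2 * C = 0 →
      A * ((1 - t ^ 2) / (2 * t)) ^ 2 + 2 * B * ((1 - t ^ 2) / (2 * t)) + C = 0 := by
    intro t ht h
    rw [path_value_factor A B C t ht] at h
    rcases mul_eq_zero.1 h with h' | h'
    · exact absurd (pow_eq_zero_iff (n := 2) (by norm_num) |>.1 h') (mul_ne_zero two_ne_zero ht)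
    · exact h'
  refine quadratic_no_three_roots hA ?_ ?_ ?_ (root t₁ h10 hz1) (root t₂ h20 hz2) (root t₃ h30 hz3)
  · exact fun h => absurd (alpha_inj h1 (by linarith) h10 (by linarith) (by linarith) h20 h) (ne_of_lt h12)
  · exact fun h => absurd (alpha_inj h1 (by linarith) h10 (by linarith) h3 h30 h) (ne_of_lt (h12.trans h23))
  · exact fun h => absurd (alpha_inj (by linarith) (by linarith) h20 (by linarith) h3 h30 h) (ne_of_lt h23)

/-- The touching path value: with `A = C = 0` the path value is `4t(1 − t²)·B`; if `B ≠ 0` it vanishes in `(−1, 1)` only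
at `t = 0`, and its values at `t = ±½` have opposite signs. [folklore] -/
theorem path_touch_values (B : ℝ) (hB : B ≠ 0) :
    (∀ t : ℝ, -1 < t → t < 1 → t ≠ 0 →
      (1 - t ^ 2) ^ 2 * 0 + 2 * (1 - t ^ 2) * (2 * t) * B + (2 * t) ^ 2 * 0 ≠ 0) ∧
    ((1 - (1 / 2 : ℝ) ^ 2) ^ 2 * 0 + 2 * (1 - (1 / 2 : ℝ) ^ 2) * (2 * (1 / 2)) * B + (2 * (1 / 2 : ℝ)) ^ 2 * 0)
      * ((1 - (-1 / 2 : ℝ) ^ 2) ^ 2 * 0 + 2 * (1 - (-1 / 2 : ℝ) ^ 2) * (2 * (-1 / 2)) * B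
          + (2 * (-1 / 2 : ℝ)) ^ 2 * 0) < 0 := by
  constructor
  · intro t ht1 ht2 ht0 h
    have h' : 4 * t * (1 - t ^ 2) * B = 0 := by linear_combination h
    rcases mul_eq_zero.1 h' with h'' | h''
    · rcases mul_eq_zero.1 h'' with h3 | h3
      · rcases mul_eq_zero.1 h3 with h4 | h4
        · norm_num at h4
        · exact ht0 h4
      · nlinarith
    · exact hB h''
  · have hB2 : 0 < B ^ 2 := by positivity
    nlinarith

end Path

end DefiniteMoments

end Summit.ValiantsHypothesis.ValiantsHypothesis.Theorems.LacunarySymmetroidMatrixDescartes
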